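import Summits.QuantumAdvantage.QuantumAdvantage.Theorems.NearExactIsExact.Negative.LevelSixSixtyOnePrep
import Summits.QuantumAdvantage.QuantumAdvantage.Theorems.CubicForrelationNearExactIsExactFourteenSecondStructure

/-!
# The mod-4 character engine at the boundary `Φ = 61/64` (NearExactIsExact, disprover gen 24)

Negative/structural lemmas for the crux `CubicForrelation.NearExactIsExact` (item r2), finite slice `n = 14`.
HONEST FRAMING: statements about cubic Boolean functions on 14 bits — NOT summit progress; no violation of `NearExactIsExact`.

`…Negative.LevelSixSixtyOneFourteen` runs the mod-4 character argument at slack `< 2048` (`Φ > 61/64`).  Here the same engine is run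
AT the boundary (slack `≤ 2048`), with the minimal odd set `#P = 2¹²` as an explicit hypothesis (at `Φ = 61/64` Kasami–Tokura no longer
forces it) and the partner `f` an ARBITRARY Boolean function:
* `lsm_dirs`: two transversal directions whose twelve translates of four points avoid `≤ 512` defects;
* `lsm_core`: `g` cubic, `W_g = 64u'`, `#{u' odd} = 2¹²`, `Σ_x (u'(x) − 2(−1)^{f(x)})² ≤ 6144` ⇒ `|256(−1)^{g(y)} − 2W_f(y)| ≥ 3072` at
  four frequencies `y` (odd set a 12-flat `x₁ ⊕ V₀`; `≤ 512` even defects; `4 ∣` the residual sum over every 2-flat of the coset, so the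
  mod-4 sign is a `±`character with transform `±2¹²` at exactly four frequencies; the residual is within `ℓ¹`-distance `1024` of it).
The consequences (no minimal level-6 side at `Φ ≥ 61/64` against any cubic partner) are drawn in `…Negative.LevelSixMinimalSixtyOne`.

References: T. Kasami, N. Tokura, IEEE Trans. Inform. Theory 16 (1970); R. O'Donnell (2014) §3.3.  Standard axioms only.
-/

set_option linter.dupNamespace false -- D-0017: single-problem summit ⇒ `QuantumAdvantage.QuantumAdvantage` by design

noncomputable section

namespace Summit.QuantumAdvantage.QuantumAdvantage.Theorems.NearExactIsExact.Negative.LevelSixMinimalCore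

open Finset
open Literature.Computability.QuantumComplexity
open Literature.Computability.QuantumComplexity.BuzetChailloux (bxor zeroVec bxor_bxor_cancel_left bxor_zeroVec zeroVec_bxor bxor_comm
  bxor_self signOf_sq)
open Literature.Computability.QuantumComplexity.DerivativeWalsh (W sum_W_sq twist_bxor_left sum_char_subspace)
open Summit.QuantumAdvantage.QuantumAdvantage.Theorems.CubicForrelation.NearExactIsExact
open Summit.QuantumAdvantage.QuantumAdvantage.Theorems.SignedCubicForrelationNotPrBPP.Negative.HalfQuad (forrelation_comm)
open Summit.QuantumAdvantage.QuantumAdvantage.Theorems.NearExactIsExact.Negative.LevelSixSixtyOnePrep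

/-! ### Two transversal directions avoiding `≤ 512` defects -/

/-- `lsp_dirs` at the boundary: the same greedy count with `#D ≤ 512` (`4096 + 2048 < 2¹⁴`, `8192 + 4096 < 2¹⁴`). [folklore] -/
theorem lsm_dirs (V₀ D : Finset (Fin (7 + 7) → Bool)) (hV : #V₀ ≤ 4096) (hD : #D ≤ 512) (p₀ p₁ p₂ p₃ : Fin (7 + 7) → Bool) :
    ∃ d₁ d₂ : Fin (7 + 7) → Bool, d₁ ∉ V₀ ∧ d₂ ∉ V₀ ∧ bxor d₁ d₂ ∉ V₀ ∧
      ∀ p ∈ ({p₀, p₁, p₂, p₃} : Finset (Fin (7 + 7) → Bool)),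
        bxor p d₂ ∉ D ∧ bxor p d₁ ∉ D ∧ bxor (bxor p d₂) d₁ ∉ D := by
  classical
  set S : Finset (Fin (7 + 7) → Bool) := {p₀, p₁, p₂, p₃} with hSdef
  have hS : #S ≤ 4 := card_le_four
  have huniv : #(univ : Finset (Fin (7 + 7) → Bool)) = 16384 := by simp
  -- `Bad t` = the directions `d` for which some `p ⊕ d ⊕ t` is a defect
  set Bad : (Fin (7 + 7) → Bool) → Finset (Fin (7 + 7) → Bool) :=
    fun t => S.biUnion fun p => D.image fun δ => bxor p (bxor δ t) with hBad
  have hBadcard : ∀ t, #(Bad t) ≤ 2048 := by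
    intro t
    calc #(Bad t) ≤ ∑ p ∈ S, #(D.image fun δ => bxor p (bxor δ t)) := card_biUnion_le
      _ ≤ ∑ p ∈ S, #D := sum_le_sum fun p _ => card_image_le
      _ = #S * #D := by rw [sum_const, smul_eq_mul]
      _ ≤ 4 * 512 := Nat.mul_le_mul hS hD
  have hgood : ∀ t d, d ∉ Bad t → ∀ p ∈ S, bxor (bxor p d) t ∉ D := by
    intro t d hd p hp hmem
    apply hd
    refine mem_biUnion.2 ⟨p, hp, mem_image.2 ⟨bxor (bxor p d) t, hmem, ?_⟩⟩
    rw [iw_bxor_assoc (bxor p d) t t, bxor_self, bxor_zeroVec, bxor_bxor_cancel_left]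
  -- the first direction
  have h1 : #(V₀ ∪ Bad zeroVec) < #(univ : Finset (Fin (7 + 7) → Bool)) := by
    rw [huniv]
    calc #(V₀ ∪ Bad zeroVec) ≤ #V₀ + #(Bad zeroVec) := card_union_le _ _
      _ ≤ 4096 + 2048 := Nat.add_le_add hV (hBadcard _)
      _ < 16384 := by norm_num
  obtain ⟨d₁, -, hd₁⟩ := exists_mem_notMem_of_card_lt_card h1
  rw [mem_union, not_or] at hd₁
  -- the second direction
  have h2 : #(((V₀ ∪ V₀.image (bxor d₁)) ∪ Bad zeroVec) ∪ Bad d₁) < #(univ : Finset (Fin (7 + 7) → Bool)) := by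
    rw [huniv]
    calc #(((V₀ ∪ V₀.image (bxor d₁)) ∪ Bad zeroVec) ∪ Bad d₁)
        ≤ #((V₀ ∪ V₀.image (bxor d₁)) ∪ Bad zeroVec) + #(Bad d₁) := card_union_le _ _
      _ ≤ (#(V₀ ∪ V₀.image (bxor d₁)) + #(Bad zeroVec)) + #(Bad d₁) := Nat.add_le_add_right (card_union_le _ _) _
      _ ≤ ((#V₀ + #(V₀.image (bxor d₁))) + #(Bad zeroVec)) + #(Bad d₁) :=
          Nat.add_le_add_right (Nat.add_le_add_right (card_union_le _ _) _) _
      _ ≤ ((4096 + 4096) + 2048) + 2048 :=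
          Nat.add_le_add (Nat.add_le_add (Nat.add_le_add hV (card_image_le.trans hV)) (hBadcard _)) (hBadcard _)
      _ < 16384 := by norm_num
  obtain ⟨d₂, -, hd₂⟩ := exists_mem_notMem_of_card_lt_card h2
  simp only [mem_union, not_or] at hd₂
  obtain ⟨⟨⟨hd₂V, hd₂img⟩, hd₂B0⟩, hd₂B1⟩ := hd₂
  refine ⟨d₁, d₂, hd₁.1, hd₂V, fun h => hd₂img (mem_image.2 ⟨bxor d₁ d₂, h, bxor_bxor_cancel_left d₁ d₂⟩), ?_⟩
  intro p hp
  refine ⟨?_, ?_, hgood d₁ d₂ hd₂B1 p hp⟩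
  · have h := hgood zeroVec d₂ hd₂B0 p hp
    rwa [bxor_zeroVec] at h
  · have h := hgood zeroVec d₁ hd₁.2 p hp
    rwa [bxor_zeroVec] at h

/-! ### The character engine at slack `≤ 2048` -/

set_option maxHeartbeats 1600000 in
/-- **Engine.**  `g` cubic on 14 bits with `W_g = 64u'`, `u'(x₁)` odd, odd set of size `2¹²`, and residual budget
`Σ_x (u'(x) − 2(−1)^{f(x)})² ≤ 6144` against an ARBITRARY Boolean `f`: there are four frequencies `y` with
`|256(−1)^{g(y)} − 2W_f(y)| ≥ 3072`.  (Steps (6)–(12) of `levelSix_pair_false_61` at the boundary.)  NOT summit progress. [this work] -/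
theorem lsm_core (f g : (Fin (7 + 7) → Bool) → Bool) (hg : IsDegLeFun 3 g)
    (u' : (Fin (7 + 7) → Bool) → ℤ) (hu' : ∀ x, W (fun y => signOf (g y)) x = (2 : ℝ) ^ 6 * (u' x : ℝ))
    (x₁ : Fin (7 + 7) → Bool) (hx₁ : Odd (u' x₁))
    (hPcard : #(univ.filter fun x : Fin (7 + 7) → Bool => decide (Odd (u' x)) = true) = 4096)
    (hB : (∑ x, (u' x - 2 * sZ (f x)) ^ 2 : ℤ) ≤ 6144) :
    ∃ F : Finset (Fin (7 + 7) → Bool), #F = 4 ∧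
      ∀ y ∈ F, (3072 : ℝ) ≤ |256 * signOf (g y) - 2 * W (fun x => signOf (f x)) y| := by
  classical
  have hp : IsDegLeFun 2 (fun x => decide (Odd (u' x))) :=
    stub_walshTower stub_axParity (7 + 7) 6 2 g u' hg hu' (by intro k hk hkn; omega)
  set B : ℤ := ∑ x, (u' x - 2 * sZ (f x)) ^ 2 with hBdef
  have hfilt : (univ.filter fun x : Fin (7 + 7) → Bool => decide (Odd (u' x)) = true) = univ.filter fun x => Odd (u' x) :=
    filter_congr fun x _ => by rw [decide_eq_true_iff]
  have hPcard' : #(univ.filter fun x : Fin (7 + 7) → Bool => Odd (u' x)) = 4096 := by rw [← hfilt]; exact hPcard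
  have hsumP : (∑ x, (if Odd (u' x) then 1 else 0 : ℤ)) = #(univ.filter fun x : Fin (7 + 7) → Bool => Odd (u' x)) := by
    rw [sum_boole]
  have hodd_e : ∀ x, Odd (u' x) → Odd (u' x - 2 * sZ (f x)) := fun x h => Int.odd_sub.2 (iff_of_true h (even_two_mul _))
  have hbase : ∀ x, (if Odd (u' x) then 1 else 0 : ℤ) ≤ (u' x - 2 * sZ (f x)) ^ 2 := by
    intro x
    by_cases h : Odd (u' x)
    · rw [if_pos h]; exact tp_res_sq_ge_one (tp_sZ_cases (f x)) h
    · rw [if_neg h]; exact sq_nonneg _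
  -- (6) the odd set is a 12-flat `x₁ ⊕ V₀`
  obtain ⟨h0, hadd, hcardV, hcoset⟩ := qf_flat_of_quadratic (fun x => decide (Odd (u' x))) hp hPcard
  set V₀ := univ.filter (fun a : Fin (7 + 7) → Bool => ∀ x, decide (Odd (u' (bxor x a))) = decide (Odd (u' x))) with hV₀
  have hPimg := hcoset x₁ (decide_eq_true hx₁)
  have hmemP : ∀ x, x ∈ (univ.filter fun x : Fin (7 + 7) → Bool => decide (Odd (u' x)) = true) ↔ Odd (u' x) := by
    intro x; simp
  have hin : ∀ z, Odd (u' z) → ∀ c ∈ V₀, Odd (u' (bxor z c)) := by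
    intro z hz c hc
    have h := (mem_filter.1 hc).2 z
    rw [decide_eq_decide] at h
    exact h.2 hz
  have hout : ∀ z, Odd (u' z) → ∀ t, t ∉ V₀ → ¬ Odd (u' (bxor z t)) := by
    intro z hz t ht hzt
    apply ht
    have key := fl_coset_translate V₀ _ x₁ hadd hPimg ((hmemP z).2 hz) h0 t
    rw [bxor_zeroVec] at key
    exact key.1 ((hmemP _).2 hzt)
  -- (7) the off-`P` defects `D` and their number
  set D := univ.filter (fun x : Fin (7 + 7) → Bool => ¬ Odd (u' x) ∧ u' x - 2 * sZ (f x) ≠ 0) with hDdef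
  have hz : ∀ q, ¬ Odd (u' q) → q ∉ D → 2 * u' q - 4 * sZ (f q) = 0 := by
    intro q hq hqD
    by_contra hne
    exact hqD (mem_filter.2 ⟨mem_univ _, hq, fun h => hne (by rw [show 2 * u' q - 4 * sZ (f q) = 2 * (u' q - 2 * sZ (f q)) by ring,
      h, mul_zero])⟩)
  have hDcard : #D ≤ 512 := by
    have h1 : ∀ x ∈ D, (4 : ℤ) ≤ (u' x - 2 * sZ (f x)) ^ 2 - (if Odd (u' x) then 1 else 0 : ℤ) := by
      intro x hx
      obtain ⟨hxo, hxe⟩ := (mem_filter.1 hx).2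
      rw [if_neg hxo, sub_zero]
      exact lsp_even_ne_zero_sq _ (fun h => hxo ((Int.odd_sub.1 h).2 (even_two_mul _))) hxe
    have h2 : ∑ x ∈ D, ((u' x - 2 * sZ (f x)) ^ 2 - (if Odd (u' x) then 1 else 0 : ℤ)) ≤
        ∑ x, ((u' x - 2 * sZ (f x)) ^ 2 - (if Odd (u' x) then 1 else 0 : ℤ)) :=
      sum_le_sum_of_subset_of_nonneg (subset_univ D) (fun x _ _ => by linarith [hbase x])
    have h3 : (4 : ℤ) * #D ≤ B - 4096 := by
      calc (4 : ℤ) * #D = ∑ x ∈ D, (4 : ℤ) := by rw [sum_const, nsmul_eq_mul]; ring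
        _ ≤ ∑ x ∈ D, ((u' x - 2 * sZ (f x)) ^ 2 - (if Odd (u' x) then 1 else 0 : ℤ)) := sum_le_sum h1
        _ ≤ ∑ x, ((u' x - 2 * sZ (f x)) ^ 2 - (if Odd (u' x) then 1 else 0 : ℤ)) := h2
        _ = B - #(univ.filter fun x : Fin (7 + 7) → Bool => Odd (u' x)) := by rw [sum_sub_distrib, hsumP]
        _ = B - 4096 := by rw [hPcard']; norm_num
    omega
  -- (8) the mod-4 sign is multiplicative on the coset through `x₁`
  have hmul : ∀ c ∈ V₀, ∀ c' ∈ V₀,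
      (2 - (u' (bxor x₁ (bxor c c')) - 2 * sZ (f (bxor x₁ (bxor c c')))) % 4) * (2 - (u' x₁ - 2 * sZ (f x₁)) % 4) =
        (2 - (u' (bxor x₁ c) - 2 * sZ (f (bxor x₁ c))) % 4) * (2 - (u' (bxor x₁ c') - 2 * sZ (f (bxor x₁ c'))) % 4) := by
    intro c hc c' hc'
    obtain ⟨d₁, d₂, hd₁, hd₂, hd₁₂, hgood⟩ :=
      lsm_dirs V₀ D (by rw [hcardV]) hDcard x₁ (bxor x₁ c') (bxor x₁ c) (bxor (bxor x₁ c') c)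
    have hd₂₁ : bxor d₂ d₁ ∉ V₀ := by rwa [bxor_comm] at hd₁₂
    have hg0 := hgood x₁ (by simp)
    have hg1 := hgood (bxor x₁ c') (by simp)
    have hg2 := hgood (bxor x₁ c) (by simp)
    have hg3 := hgood (bxor (bxor x₁ c') c) (by simp)
    have hu2 : ∀ x, W (fun y => signOf (g y)) x = (2 : ℝ) ^ 5 * ((2 * u' x : ℤ) : ℝ) := by
      intro x; rw [hu' x]; push_cast; ring
    have h8 := fs_flat_sum_dvd (e := 3) g (fun x => 2 * u' x) hg hu2 x₁
      (Fin.cons d₁ (Fin.cons d₂ (Fin.cons c (Fin.cons c' (fun i : Fin 0 => i.elim0) : Fin 1 → Fin (7 + 7) → Bool)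
        : Fin 2 → Fin (7 + 7) → Bool) : Fin 3 → Fin (7 + 7) → Bool) : Fin 4 → Fin (7 + 7) → Bool) (by norm_num)
    -- the sign part: `Σ_ε 4·s(f(pt ε)) ∈ 8ℤ` (sixteen odd terms)
    have hsZ : (8 : ℤ) ∣ ∑ ε : Fin 4 → Bool, 4 * sZ (f (fun j => x₁ j ^^ decide (Odd #(univ.filter fun i : Fin 4 => ε i &&
        (Fin.cons d₁ (Fin.cons d₂ (Fin.cons c (Fin.cons c' (fun i : Fin 0 => i.elim0) : Fin 1 → Fin (7 + 7) → Bool)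
          : Fin 2 → Fin (7 + 7) → Bool) : Fin 3 → Fin (7 + 7) → Bool) : Fin 4 → Fin (7 + 7) → Bool) i j)))) := by
      have e1 : ∀ b : Bool, 4 * sZ b = 4 - 8 * (if b then 1 else 0 : ℤ) := by intro b; cases b <;> simp [sZ]
      simp_rw [e1]
      rw [sum_sub_distrib, sum_const, card_univ, Fintype.card_fun, Fintype.card_bool, Fintype.card_fin, ← mul_sum]
      exact ⟨8 - ∑ ε : Fin 4 → Bool, (if f (fun j => x₁ j ^^ decide (Odd #(univ.filter fun i : Fin 4 => ε i &&
        (Fin.cons d₁ (Fin.cons d₂ (Fin.cons c (Fin.cons c' (fun i : Fin 0 => i.elim0) : Fin 1 → Fin (7 + 7) → Bool)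
          : Fin 2 → Fin (7 + 7) → Bool) : Fin 3 → Fin (7 + 7) → Bool) : Fin 4 → Fin (7 + 7) → Bool) i j))) then 1 else 0 : ℤ),
        by norm_num; ring⟩
    have hδ8 : (8 : ℤ) ∣ ∑ ε : Fin 4 → Bool, (2 * u' (fun j => x₁ j ^^ decide (Odd #(univ.filter fun i : Fin 4 => ε i &&
        (Fin.cons d₁ (Fin.cons d₂ (Fin.cons c (Fin.cons c' (fun i : Fin 0 => i.elim0) : Fin 1 → Fin (7 + 7) → Bool)
          : Fin 2 → Fin (7 + 7) → Bool) : Fin 3 → Fin (7 + 7) → Bool) : Fin 4 → Fin (7 + 7) → Bool) i j))) -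
        4 * sZ (f (fun j => x₁ j ^^ decide (Odd #(univ.filter fun i : Fin 4 => ε i &&
        (Fin.cons d₁ (Fin.cons d₂ (Fin.cons c (Fin.cons c' (fun i : Fin 0 => i.elim0) : Fin 1 → Fin (7 + 7) → Bool)
          : Fin 2 → Fin (7 + 7) → Bool) : Fin 3 → Fin (7 + 7) → Bool) : Fin 4 → Fin (7 + 7) → Bool) i j))))) := by
      rw [sum_sub_distrib]
      exact dvd_sub h8 hsZ
    simp only [tep_sum_split, Fintype.sum_unique, fl_pt_four, Bool.true_and, Bool.false_and, es_bxor_false,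
      show (fun j => c j) = c from rfl, show (fun j => c' j) = c' from rfl, show (fun j => d₁ j) = d₁ from rfl,
      show (fun j => d₂ j) = d₂ from rfl] at hδ8
    -- the four coset points are odd, the twelve translates are even and defect-free (so `u' = 2s` there)
    have o0 : Odd (u' x₁) := hx₁
    have o1 : Odd (u' (bxor x₁ c')) := hin _ hx₁ c' hc'
    have o2 : Odd (u' (bxor x₁ c)) := hin _ hx₁ c hc
    have o3 : Odd (u' (bxor (bxor x₁ c') c)) := hin _ o1 c hc
    have zA : ∀ p : Fin (7 + 7) → Bool, Odd (u' p) → bxor p d₂ ∉ D → 2 * u' (bxor p d₂) - 4 * sZ (f (bxor p d₂)) = 0 :=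
      fun p hp' hpD => hz _ (hout p hp' d₂ hd₂) hpD
    have zB : ∀ p : Fin (7 + 7) → Bool, Odd (u' p) → bxor p d₁ ∉ D → 2 * u' (bxor p d₁) - 4 * sZ (f (bxor p d₁)) = 0 :=
      fun p hp' hpD => hz _ (hout p hp' d₁ hd₁) hpD
    have zC : ∀ p : Fin (7 + 7) → Bool, Odd (u' p) → bxor (bxor p d₂) d₁ ∉ D →
        2 * u' (bxor (bxor p d₂) d₁) - 4 * sZ (f (bxor (bxor p d₂) d₁)) = 0 := by
      intro p hp' hpD
      have hno : ¬ Odd (u' (bxor (bxor p d₂) d₁)) := by rw [iw_bxor_assoc]; exact hout p hp' (bxor d₂ d₁) hd₂₁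
      exact hz _ hno hpD
    rw [zA _ o0 hg0.1, zA _ o1 hg1.1, zA _ o2 hg2.1, zA _ o3 hg3.1, zB _ o0 hg0.2.1, zB _ o1 hg1.2.1, zB _ o2 hg2.2.1,
      zB _ o3 hg3.2.1, zC _ o0 hg0.2.2, zC _ o1 hg1.2.2, zC _ o2 hg2.2.2, zC _ o3 hg3.2.2] at hδ8
    have h4 : (4 : ℤ) ∣ (u' x₁ - 2 * sZ (f x₁)) + (u' (bxor x₁ c') - 2 * sZ (f (bxor x₁ c'))) +
        (u' (bxor x₁ c) - 2 * sZ (f (bxor x₁ c))) + (u' (bxor (bxor x₁ c') c) - 2 * sZ (f (bxor (bxor x₁ c') c))) := by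
      omega
    have key := lsp_chi_mul (hodd_e _ o0) (hodd_e _ o1) (hodd_e _ o2) (hodd_e _ o3) h4
    rw [iw_bxor_assoc, bxor_comm c' c] at key
    rw [key, mul_comm]
  -- (9) the residual `A = e` and its mod-4 character `At = χ·1_P`
  let A : (Fin (7 + 7) → Bool) → ℝ := fun x => ((u' x - 2 * sZ (f x) : ℤ) : ℝ)
  let Ct : (Fin (7 + 7) → Bool) → ℤ := fun x => if Odd (u' x) then 2 - (u' x - 2 * sZ (f x)) % 4 else 0
  let At : (Fin (7 + 7) → Bool) → ℝ := fun x => ((Ct x : ℤ) : ℝ)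
  have hCt_on : ∀ x, Odd (u' x) → Ct x = 1 ∨ Ct x = -1 := by
    intro x hx
    rcases lsp_chi_cases _ (hodd_e x hx) with ⟨h, -⟩ | ⟨h, -⟩
    · left; simp only [Ct, if_pos hx, h]
    · right; simp only [Ct, if_pos hx, h]
  have hAton : ∀ c₀ ∈ V₀, At (bxor x₁ c₀) = 1 ∨ At (bxor x₁ c₀) = -1 := by
    intro c₀ hc₀
    rcases hCt_on _ (hin _ hx₁ c₀ hc₀) with h | h
    · left; simp only [At, h]; norm_num
    · right; simp only [At, h]; norm_num
  have hmulAt : ∀ c₀ ∈ V₀, ∀ c₀' ∈ V₀, At (bxor x₁ (bxor c₀ c₀')) * At x₁ = At (bxor x₁ c₀) * At (bxor x₁ c₀') := by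
    intro c₀ hc₀ c₀' hc₀'
    have o1 := hin _ hx₁ c₀ hc₀
    have o2 := hin _ hx₁ c₀' hc₀'
    have o3 := hin _ hx₁ (bxor c₀ c₀') (hadd _ hc₀ _ hc₀')
    simp only [At, Ct, if_pos hx₁, if_pos o1, if_pos o2, if_pos o3]
    exact_mod_cast hmul c₀ hc₀ c₀' hc₀'
  have hAtoff : ∀ x, ¬ Odd (u' x) → At x = 0 := by
    intro x hx; simp only [At, Ct, if_neg hx]; norm_num
  have hWAt : ∀ y, W At y = 0 ∨ W At y = 4096 ∨ W At y = -4096 := by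
    intro y
    have hsplit : W At y = ∑ c₀ ∈ V₀, At (bxor x₁ c₀) * twist (bxor x₁ c₀) y := by
      unfold W
      rw [← sum_filter_add_sum_filter_not univ (fun x : Fin (7 + 7) → Bool => decide (Odd (u' x)) = true)]
      have hzs : ∑ x ∈ univ.filter (fun x : Fin (7 + 7) → Bool => ¬ decide (Odd (u' x)) = true), At x * twist x y = 0 := by
        refine sum_eq_zero fun x hx => ?_
        have hx' : ¬ Odd (u' x) := by simpa using (mem_filter.1 hx).2
        rw [hAtoff x hx', zero_mul]
      rw [hzs, add_zero, hPimg, sum_image fun a _ b _ hab => by simpa only [bxor_bxor_cancel_left] using congrArg (bxor x₁) hab]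
    obtain ⟨r, hr, hsum⟩ := fl_char_coset V₀ h0 hadd x₁ At hAton hmulAt y
    rw [hsplit, hsum, hcardV]
    rcases hr with h | h | h <;> rw [h] <;> norm_num
  -- Parseval for `At`: `Σ_y Ât(y)² = 2¹⁴·2¹²`, hence exactly four frequencies
  have hPAt : ∑ y, W At y ^ 2 = (2 : ℝ) ^ (7 + 7) * 4096 := by
    rw [sum_W_sq]
    congr 1
    have hsq : ∀ x, At x ^ 2 = ((if Odd (u' x) then 1 else 0 : ℤ) : ℝ) := by
      intro x
      by_cases hx : Odd (u' x)
      · rw [if_pos hx]; rcases hCt_on x hx with h | h <;> simp only [At, h] <;> norm_num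
      · rw [if_neg hx, hAtoff x hx]; norm_num
    rw [sum_congr rfl fun x _ => hsq x, ← Int.cast_sum, hsumP, hPcard']
    norm_num
  set F := univ.filter (fun y : Fin (7 + 7) → Bool => W At y ≠ 0) with hFdef
  have hF4 : #F = 4 := lsp_four_freq (W At) hWAt hPAt
  -- (10) Walsh inversion: `Â = 256(−1)^g − 2 W_f`
  have hinv : ∀ y, ∑ x, (u' x : ℝ) * twist x y = 256 * signOf (g y) := by
    intro y
    have h := tz_inversion (fun z => signOf (g z)) y
    rw [sum_congr rfl fun x _ => by rw [hu' x]] at h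
    have e : ∑ x, (2 : ℝ) ^ 6 * (u' x : ℝ) * twist x y = 2 ^ 6 * ∑ x, (u' x : ℝ) * twist x y := by
      rw [mul_sum]
      exact sum_congr rfl fun x _ => by ring
    rw [e] at h
    have h' : (2 : ℝ) ^ 6 * (∑ x, (u' x : ℝ) * twist x y - 256 * signOf (g y)) = 0 := by
      rw [mul_sub, h]; norm_num; ring
    have h2 : (2 : ℝ) ^ 6 ≠ 0 := by positivity
    linarith [(mul_eq_zero.1 h').resolve_left h2]
  have hWA : ∀ y, W A y = 256 * signOf (g y) - 2 * W (fun x => signOf (f x)) y := by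
    intro y
    unfold W
    have e : ∀ x, A x * twist x y = (u' x : ℝ) * twist x y - 2 * (signOf (f x) * twist x y) := by
      intro x
      simp only [A]
      push_cast
      rw [tp_sZ_cast]
      ring
    rw [sum_congr rfl fun x _ => e x, sum_sub_distrib, ← mul_sum, hinv y]
  -- (11) the residual is close to its character: `Σ_x |e − χ1_P| ≤ (B − 2¹²)/2`
  have herr : 2 * (∑ x, |(u' x - 2 * sZ (f x)) - Ct x|) ≤ B - 4096 := by
    have hpt : ∀ x, 2 * |(u' x - 2 * sZ (f x)) - Ct x| ≤ (u' x - 2 * sZ (f x)) ^ 2 - (if Odd (u' x) then 1 else 0 : ℤ) := by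
      intro x
      by_cases hx : Odd (u' x)
      · simp only [Ct, if_pos hx]
        exact lsp_cost_on _ (hodd_e x hx)
      · simp only [Ct, if_neg hx, sub_zero]
        exact lsp_cost_off _ (fun h => hx ((Int.odd_sub.1 h).2 (even_two_mul _)))
    have h := sum_le_sum fun x (_ : x ∈ (univ : Finset (Fin (7 + 7) → Bool))) => hpt x
    rw [← mul_sum, sum_sub_distrib, hsumP, hPcard'] at h
    norm_num at h
    linarith
  have hdiff : ∀ y, |W A y - W At y| ≤ (((B - 4096 : ℤ)) : ℝ) / 2 := by
    intro y
    have h := lsp_W_diff_le (fun x => u' x - 2 * sZ (f x)) Ct y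
    have h2 : ((∑ x, |(u' x - 2 * sZ (f x)) - Ct x| : ℤ) : ℝ) ≤ (((B - 4096 : ℤ)) : ℝ) / 2 := by
      have : (((2 * ∑ x, |(u' x - 2 * sZ (f x)) - Ct x| : ℤ)) : ℝ) ≤ (((B - 4096 : ℤ)) : ℝ) := by exact_mod_cast herr
      push_cast at this ⊢
      linarith
    exact h.trans h2
  -- (12) at the four frequencies `|Â| ≥ 4096 − 1024 = 3072`
  refine ⟨F, hF4, fun y hy => ?_⟩
  have hne : W At y ≠ 0 := (mem_filter.1 hy).2
  have habs : |W At y| = 4096 := by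
    rcases hWAt y with h | h | h
    · exact absurd h hne
    · rw [h]; norm_num
    · rw [h]; norm_num
  have h1 : (4096 : ℝ) ≤ |W A y| + (((B - 4096 : ℤ)) : ℝ) / 2 := by
    have := abs_sub_abs_le_abs_sub (W At y) (W A y)
    rw [abs_sub_comm] at this
    linarith [hdiff y]
  have hB' : (((B - 4096 : ℤ)) : ℝ) ≤ 2048 := by
    have : B - 4096 ≤ 2048 := by omega
    exact_mod_cast this
  rw [hWA y] at h1
  linarith

end Summit.QuantumAdvantage.QuantumAdvantage.Theorems.NearExactIsExact.Negative.LevelSixMinimalCore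

end
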